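import Summits.Parity.GeneralizedHardyLittlewood.Theorems.GreenTaoLevelTwoGITwoCyclicInverseLocalHomBohr
import Summits.Parity.GeneralizedHardyLittlewood.Theorems.GreenTaoLevelTwoGITwoCyclicInverseBohrRegular

/-!
# Route `GreenTaoLevelTwo`, crux `GITwo` (stmt-Parity-21275), line `birth`, stub `stub_cyclicInverse`:
# large `U³` norm ⇒ locally linear phase derivative (GT08a arXiv Prop. 43, qualitative)

Thirty-fifth helper file toward the XL stub `stub_cyclicInverse` (B. Green, T. Tao, *An inverse
theorem for the Gowers `U³(G)` norm*, arXiv:math/0503014, Thm. 68 = PEMS 51 (2008) Thm. 12.8).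
Block C10: the remaining bookkeeping of arXiv Prop. 43 on top of `exists_locally_additive_on_bohr`
(`…LocalHomBohr`): keep the GRAPH property of the section `μ` (`μ p.1 = p.2` on `2Γ'' − 2Γ''`), make
the Bohr set `B₁ = B(Spec, ρ)` REGULAR with `ρ ∈ [1/16, 1/8]` (`exists_regular_bohr`, arXiv Lemma 36),
choose the base point `x₀` by averaging over `ℤ/Mℤ` (arXiv Lemma 20), and produce the affine form
`ξ_{x₀+h} = ξ₀ + μ h` on `A = {h ∈ B₁ : x₀ + h ∈ H''}` (the paper's `2Mh + ξ₀`; here `μ = 2M`).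

* `sub_subset_two_nsmul_sub` — `Γ − Γ ⊆ 2Γ − 2Γ` for nonempty `Γ`;
* `exists_translate_card_ge` — **arXiv Lemma 20** in `ℤ/Mℤ`: some translate `x₀ + B` meets `H` in
  at least `#B #H / M` points;
* `exists_locally_linear_phase` — **arXiv Prop. 43 (qualitative)**: for `M` prime, `|f| ≤ 1`,
  `‖f‖_{U³}^8 ≥ ε > 0` there are `H''`, `ξ` (`|(Δ_t f)^(ξ_t)|² ≥ ε/2` on `H''`,
  `#H'' ≥ ε¹⁷M/(2²³128^d)`, `d ≤ (2²²⁵ε⁻¹⁶⁸)¹⁷`), a spectrum `Spec` (`#Spec·β³/4 ≤ β`,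
  `β = #H''/M`), a regular `B₁ = B(Spec,ρ)`, `ρ ∈ [1/16,1/8]`, a map `μ` additive on `B(Spec,¼)`,
  `x₀, ξ₀` with `#{h ∈ B₁ : x₀+h ∈ H''} ≥ #B₁ #H''/M` and `ξ(x₀+h) = ξ₀ + μ h` for those `h`.

References: [GreenTao2008U3Inverse] arXiv:math/0503014, Prop. 43, Lemma 20, Lemma 36.
-/

noncomputable section

namespace Summit.Parity.GeneralizedHardyLittlewood.GreenTaoLevelTwoGITwoCyclicInverse

open Finset
open scoped Pointwise

open Literature.NumberTheory.Sieve

variable {M : ℕ} [NeZero M]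

omit [NeZero M] in
/-- `Γ − Γ ⊆ 2Γ − 2Γ` for nonempty `Γ`. [folklore] -/
theorem sub_subset_two_nsmul_sub {α : Type*} [AddCommGroup α] [DecidableEq α] (Γ : Finset α)
    (hne : Γ.Nonempty) : Γ - Γ ⊆ 2 • Γ - 2 • Γ := by
  obtain ⟨e, he⟩ := hne
  intro x hx
  rw [Finset.mem_sub] at hx ⊢
  obtain ⟨a, ha, b, hb, rfl⟩ := hx
  refine ⟨a + e, ?_, b + e, ?_, by abel⟩
  · rw [two_nsmul]; exact add_mem_add ha he
  · rw [two_nsmul]; exact add_mem_add hb he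

/-- **Averaging over translates (GT08a arXiv Lemma 20 in `ℤ/Mℤ`).**  For finsets `B, H ⊆ ℤ/Mℤ` some
translate `x₀ + B` meets `H` in at least `#B #H / M` points. [cite: GreenTao2008U3Inverse, Lemma 20] -/
theorem exists_translate_card_ge (B H : Finset (ZMod M)) :
    ∃ x₀ : ZMod M, (#B : ℝ) * #H / M ≤ #(B.filter fun h => x₀ + h ∈ H) := by
  classical
  have hMpos : (0 : ℝ) < M := by exact_mod_cast Nat.pos_of_ne_zero (NeZero.ne M)
  -- double counting: `Σ_{x₀} #{h ∈ B : x₀ + h ∈ H} = #B · #H`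
  have hcount : ∑ x₀ : ZMod M, (#(B.filter fun h => x₀ + h ∈ H) : ℝ) = #B * #H := by
    have h1 : ∀ x₀ : ZMod M, (#(B.filter fun h => x₀ + h ∈ H) : ℝ) =
        ∑ h ∈ B, if x₀ + h ∈ H then (1 : ℝ) else 0 := fun x₀ => by
      rw [Finset.sum_boole]
    simp_rw [h1]
    rw [Finset.sum_comm]
    have h2 : ∀ h ∈ B, ∑ x₀ : ZMod M, (if x₀ + h ∈ H then (1 : ℝ) else 0) = #H := by
      intro h _
      rw [Finset.sum_boole]
      congr 1
      have : (Finset.univ.filter fun x₀ : ZMod M => x₀ + h ∈ H) = H.image fun y => y - h := by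
        ext x₀
        simp only [mem_filter, mem_univ, true_and, mem_image]
        constructor
        · intro hx; exact ⟨x₀ + h, hx, by abel⟩
        · rintro ⟨y, hy, rfl⟩; simpa using hy
      rw [this, card_image_of_injective _ (sub_left_injective)]
    rw [sum_congr rfl h2, sum_const, nsmul_eq_mul]
  have hne : (Finset.univ : Finset (ZMod M)).Nonempty := univ_nonempty
  obtain ⟨x₀, -, hx₀⟩ := Finset.exists_le_of_sum_le hne (f := fun _ => (#B : ℝ) * #H / M)
    (g := fun x₀ => (#(B.filter fun h => x₀ + h ∈ H) : ℝ)) (by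
      rw [hcount, sum_const, card_univ, ZMod.card, nsmul_eq_mul, mul_div_cancel₀ _ hMpos.ne'])
  exact ⟨x₀, hx₀⟩

/-- **GT08a arXiv Prop. 43 (qualitative): large `U³` norm gives a locally linear phase derivative.**
For `M` prime, `|f| ≤ 1` and `‖f‖_{U³}^8 ≥ ε > 0` there are: `H'' ⊆ ℤ/Mℤ` and `ξ` with
`|(Δ_t f)^(ξ_t)|² ≥ ε/2` on `H''`, `#H'' ≥ ε¹⁷M/(2²³128^d)` with `d ≤ (2²²⁵ε⁻¹⁶⁸)¹⁷`; a spectrum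
`Spec` with `#Spec·(β³/4) ≤ β`, `β = #H''/M`; a radius `ρ ∈ [1/16, 1/8]` at which
`B₁ = B(Spec, ρ)` is regular (arXiv Def. 16); a map `μ : ℤ/Mℤ → ℤ/Mℤ` additive on `B(Spec, ¼)`;
a base point `x₀` and a frequency `ξ₀` such that `A = {h ∈ B₁ : x₀ + h ∈ H''}` has
`#A ≥ #B₁ #H''/M` and `ξ(x₀ + h) = ξ₀ + μ h` for all `h ∈ A`.
[cite: GreenTao2008U3Inverse, Prop. 43] -/
theorem exists_locally_linear_phase (hM : M.Prime) {f : ZMod M → ℝ} (hf : ∀ x, |f x| ≤ 1)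
    {ε : ℝ} (hε0 : 0 < ε) (hε : ε ≤ gowersPower 3 f) :
    ∃ (H'' Spec : Finset (ZMod M)) (ξ μ : ZMod M → ZMod M) (d : ℕ) (ρ : ℝ) (x₀ ξ₀ : ZMod M),
      (d : ℝ) ≤ (2 ^ 225 / ε ^ 168) ^ 17 ∧
      (∀ t ∈ H'', ε / 2 ≤ ‖dftCoeff (fun y => f y * f (y + t)) (ξ t)‖ ^ 2) ∧
      ε ^ 17 / 2 ^ 23 * M / (128 : ℝ) ^ d ≤ #H'' ∧
      (#Spec : ℝ) * (((#H'' : ℝ) / M) ^ 3 / 4) ≤ (#H'' : ℝ) / M ∧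
      1 / 16 ≤ ρ ∧ ρ ≤ 1 / 8 ∧
      (∀ κ : ℝ, |κ| ≤ 1 / (100 * (#Spec : ℝ)) →
        (1 - 100 * (#Spec : ℝ) * |κ|) *
              #{x : ZMod M | ∀ ξ' ∈ Spec, ‖ZMod.toAddCircle (x * ξ')‖ < ρ} ≤
            #{x : ZMod M | ∀ ξ' ∈ Spec, ‖ZMod.toAddCircle (x * ξ')‖ < (1 + κ) * ρ} ∧
          (#{x : ZMod M | ∀ ξ' ∈ Spec, ‖ZMod.toAddCircle (x * ξ')‖ < (1 + κ) * ρ} : ℝ) ≤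
            (1 + 100 * (#Spec : ℝ) * |κ|) *
              #{x : ZMod M | ∀ ξ' ∈ Spec, ‖ZMod.toAddCircle (x * ξ')‖ < ρ}) ∧
      (∀ h₁ h₂ : ZMod M, (∀ ξ' ∈ Spec, ‖ZMod.toAddCircle (h₁ * ξ')‖ ≤ 1 / 4) →
        (∀ ξ' ∈ Spec, ‖ZMod.toAddCircle (h₂ * ξ')‖ ≤ 1 / 4) →
        (∀ ξ' ∈ Spec, ‖ZMod.toAddCircle ((h₁ + h₂) * ξ')‖ ≤ 1 / 4) →
        μ (h₁ + h₂) = μ h₁ + μ h₂) ∧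
      (#{x : ZMod M | ∀ ξ' ∈ Spec, ‖ZMod.toAddCircle (x * ξ')‖ < ρ} : ℝ) * #H'' / M ≤
        #(({x : ZMod M | ∀ ξ' ∈ Spec, ‖ZMod.toAddCircle (x * ξ')‖ < ρ} : Finset (ZMod M)).filter
          fun h => x₀ + h ∈ H'') ∧
      ∀ h ∈ ({x : ZMod M | ∀ ξ' ∈ Spec, ‖ZMod.toAddCircle (x * ξ')‖ < ρ} : Finset (ZMod M)),
        x₀ + h ∈ H'' → ξ (x₀ + h) = ξ₀ + μ h := by
  classical
  have hMpos : (0 : ℝ) < M := by exact_mod_cast Nat.pos_of_ne_zero (NeZero.ne M)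
  obtain ⟨H'', ξ, d, hd, hfreq, hcard, hgraph4⟩ :=
    exists_graph_slice_of_gowersPower_three hM hf hε0 hε
  set Γ'' : Finset (ZMod M × ZMod M) := H''.image fun t => (t, ξ t) with hΓ''
  have hH''pos : (0 : ℝ) < #H'' := by
    refine lt_of_lt_of_le ?_ hcard
    have h1 : (0 : ℝ) < ε ^ 17 / 2 ^ 23 * M := by positivity
    exact div_pos h1 (pow_pos (by norm_num) _)
  have hH''ne : H''.Nonempty := by
    rw [← card_pos]; exact_mod_cast hH''pos
  have hΓ''ne : Γ''.Nonempty := hH''ne.image _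
  -- the locally additive section, WITH its graph property
  obtain ⟨μ, hμgraph, hμmem, hμadd⟩ := exists_locally_additive_section Γ'' hΓ''ne hgraph4
  have hpr : Γ''.image Prod.fst = H'' := image_fst_image_graph H'' ξ
  rw [hpr] at hμmem hμadd
  -- the spectrum of `H''` and Bogolyubov
  set Spec : Finset (ZMod M) := Finset.univ.filter fun ξ' : ZMod M => ξ' ≠ 0 ∧
      ((#H'' : ℝ) / M) ^ 3 / 4 ≤ ‖dftCoeff (fun y => if y ∈ H'' then (1 : ℝ) else 0) ξ'‖ ^ 2
    with hSpec
  have hSpec_card : (#Spec : ℝ) * (((#H'' : ℝ) / M) ^ 3 / 4) ≤ (#H'' : ℝ) / M :=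
    card_largeSpec_mul_le H'' Spec fun ξ' hξ' => by
      rw [hSpec, mem_filter] at hξ'; exact hξ'.2.2
  have hbohr : ∀ h : ZMod M, (∀ ξ' ∈ Spec, ‖ZMod.toAddCircle (h * ξ')‖ ≤ 1 / 4) →
      h ∈ 2 • H'' - 2 • H'' := by
    intro h hh
    obtain ⟨a, ha, c, hc, b, hb, d', hd', heq⟩ :=
      bohr_largeSpec_subset_two_sub_two hH''ne h fun ξ' hξ'0 hspec =>
        hh ξ' (by rw [hSpec, mem_filter]; exact ⟨mem_univ _, hξ'0, hspec⟩)
    rw [← heq]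
    exact mem_two_nsmul_sub_of_repr ha hb hc hd'
  -- a regular radius `ρ ∈ [1/16, 1/8]`
  obtain ⟨ρ, hρ1, hρ2, hreg⟩ := exists_regular_bohr Spec (ε := (1 / 16 : ℝ)) (by norm_num)
  set B₁ : Finset (ZMod M) := {x : ZMod M | ∀ ξ' ∈ Spec, ‖ZMod.toAddCircle (x * ξ')‖ < ρ}
    with hB₁
  have hB₁mem : ∀ x, x ∈ B₁ → ∀ ξ' ∈ Spec, ‖ZMod.toAddCircle (x * ξ')‖ < ρ := fun x hx => by
    rw [hB₁, mem_filter] at hx; exact hx.2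
  -- the base point
  obtain ⟨x₀, hx₀⟩ := exists_translate_card_ge B₁ H''
  -- the set `A` is nonempty
  have hB₁pos : (0 : ℝ) < #B₁ := by
    have : 1 ≤ #B₁ := one_le_card_bohr Spec (by linarith : (0 : ℝ) < ρ)
    exact_mod_cast this
  have hAne : (B₁.filter fun h => x₀ + h ∈ H'').Nonempty := by
    rw [← card_pos]
    have : (0 : ℝ) < #(B₁.filter fun h => x₀ + h ∈ H'') := lt_of_lt_of_le (by positivity) hx₀
    exact_mod_cast this
  obtain ⟨h₁, hh₁⟩ := hAne
  rw [mem_filter] at hh₁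
  refine ⟨H'', Spec, ξ, μ, d, ρ, x₀, ξ (x₀ + h₁) - μ h₁, hd, hfreq, hcard, hSpec_card, hρ1,
    by linarith, hreg, fun a b ha hb hab => hμadd a b (hbohr a ha) (hbohr b hb) (hbohr _ hab),
    hx₀, fun h hh hxh => ?_⟩
  -- the affine form on `A`
  have hquarter : ∀ z : ZMod M, (∀ ξ' ∈ Spec, ‖ZMod.toAddCircle (z * ξ')‖ < 1 / 4) →
      ∀ ξ' ∈ Spec, ‖ZMod.toAddCircle (z * ξ')‖ ≤ 1 / 4 := fun z hz ξ' hξ' => (hz ξ' hξ').le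
  have hhB : ∀ ξ' ∈ Spec, ‖ZMod.toAddCircle (h * ξ')‖ < 1 / 8 :=
    fun ξ' hξ' => (hB₁mem h hh ξ' hξ').trans_le (hρ2.trans_eq (by norm_num))
  have hh₁B : ∀ ξ' ∈ Spec, ‖ZMod.toAddCircle (h₁ * ξ')‖ < 1 / 8 :=
    fun ξ' hξ' => (hB₁mem h₁ hh₁.1 ξ' hξ').trans_le (hρ2.trans_eq (by norm_num))
  have hdiff : ∀ ξ' ∈ Spec, ‖ZMod.toAddCircle ((h - h₁) * ξ')‖ < 1 / 4 := by
    intro ξ' hξ'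
    rw [sub_mul, map_sub]
    calc ‖ZMod.toAddCircle (h * ξ') - ZMod.toAddCircle (h₁ * ξ')‖
        ≤ ‖ZMod.toAddCircle (h * ξ')‖ + ‖ZMod.toAddCircle (h₁ * ξ')‖ := norm_sub_le _ _
      _ < 1 / 8 + 1 / 8 := add_lt_add (hhB ξ' hξ') (hh₁B ξ' hξ')
      _ = 1 / 4 := by norm_num
  -- `(h − h₁, ξ(x₀+h) − ξ(x₀+h₁)) ∈ Γ'' − Γ'' ⊆ 2Γ'' − 2Γ''`, so `μ (h − h₁) = ξ(x₀+h) − ξ(x₀+h₁)`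
  have hmemΓ : (h - h₁, ξ (x₀ + h) - ξ (x₀ + h₁)) ∈ 2 • Γ'' - 2 • Γ'' := by
    refine sub_subset_two_nsmul_sub Γ'' hΓ''ne ?_
    rw [Finset.mem_sub]
    refine ⟨(x₀ + h, ξ (x₀ + h)), ?_, (x₀ + h₁, ξ (x₀ + h₁)), ?_, ?_⟩
    · rw [hΓ'', mem_image]; exact ⟨x₀ + h, hxh, rfl⟩
    · rw [hΓ'', mem_image]; exact ⟨x₀ + h₁, hh₁.2, rfl⟩
    · ext <;> simp
  have hμdiff : μ (h - h₁) = ξ (x₀ + h) - ξ (x₀ + h₁) := hμgraph _ hmemΓ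
  -- additivity: `μ h = μ (h − h₁) + μ h₁`
  have hμsplit : μ h = μ (h - h₁) + μ h₁ := by
    have := hμadd (h - h₁) h₁ (hbohr _ (hquarter _ hdiff))
      (hbohr _ (hquarter _ fun ξ' hξ' => (hh₁B ξ' hξ').trans (by norm_num)))
      (by rw [sub_add_cancel]; exact hbohr _ (hquarter _ fun ξ' hξ' => (hhB ξ' hξ').trans (by norm_num)))
    rwa [sub_add_cancel] at this
  rw [hμsplit, hμdiff]
  abel

end Summit.Parity.GeneralizedHardyLittlewood.GreenTaoLevelTwoGITwoCyclicInverse
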